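import Summits.CriticalPhenomena.PercolationContinuityZ3.Theorems.Transplant.SkelSeedSlabIn
import Literature.Probability.Percolation.KozmaNitzanScheme
import HarnessLib

/-!
# L5.5b v3 — the DEEP seed slab of a window level: the slab's cylinder sits one unit off the exit face (exit-depths `[1, 2ℓs+1]`) AND
# tangentially at depth `≥ T₀ − ℓs`, `T₀ = 2ℓs + 2 + M`, so that the cube behind it has depth `≥ 2ℓs + 2` in BOTH coordinates and the
# Step-V pinning set `S = (all-coordinates shell from depth 2ℓs+2) ∪ (far faces)` holds every cube while every seed keeps an endpoint off `S`
# (lane INBOX 2026-08-20 p1-g7 20:12Z / 20:33Z; supersedes the placements of `SkelSeedSlab` (v1) and `SkelSeedSlabIn` (v2))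

builds on p205010 (kernel theorem, internal audit signed; external expert review pending) — nothing in this file uses p205010.
Lane `prim-bschramm`, seat `prim-bschramm-p1` (gen 7); helper file (`--supports stmt-CriticalPhenomena-4575 --as helper`); namespace
`Transplant.SkelI`, `[DecidableEq V]` binder for the kit statements.
The near region of a contact `x` with inner neighbour `y`, exit datum `(i₀, σ) = exitDir`, tangential coordinate `i₁ = oth i₀`:
  `S x = {y} ∪ {p₀, …, p_K} ∪ cylBallFin t ℓs R′`,
`p₀ = inward y` (one step off the exit face), `p_{k+1}` the `step`-neighbour of `p_k` in coordinate `i₁` toward the clamped tangential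
target `τ = clamp(φ y i₁, Lo i₁ + T₀, Hi i₁ − T₀)` (`K = |τ − φ y i₁| ≤ T₀`), and `t = deepCtr` the step-vertex over
`(φ y i₀ − σ(ℓs+1), τ)`; `p_K ∈ cyl(t, ℓs)`.  Every path vertex has exit-depth `1`; the cylinder has exit-depths `[1, 2ℓs+1]` and tangential
depth `≥ T₀ − ℓs = ℓs + 2 + M`.
* §1 `walk` (straight `step`-walks), `tanOff`, `tanTgt`, `deepPt`, `deepCtr`, `deepCtr_spec`, `φ_deepCtr_exit`, `depth_deepCtr_tan`;
* §2 `slabGeomDeep`, `NearFaceOKDeep`, **`kitOK_slabDeep`** (`SkelI.KitOK … ((Φ.Δ+1)^R′ + (T₀ + 2)) cU (slabGeomDeep …)`).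
The avoidance lemma (Step V's `hSseed` for `S = shell ∪ far faces`) is `SkelSeedSlabDeepAvoid.slabSeedDeep_notMem_wireSet`.
[cite: KozmaNitzan2024, §4 Lemma 10, p. 19 (Step III), p. 21 (v(P) + Λ_M, U(P), "Q ⊆ S"), pp. 21–22 (Step V)] [cite: GrimmettPercolation1999, §7.2]
-/

noncomputable section

open scoped Classical

namespace Summit.CriticalPhenomena.PercolationContinuityZ3.Theorems

namespace Transplant

namespace SkelI

open Literature.Probability.Percolation Literature.Probability.LatticeModels SimpleGraph KNLevels
open Literature.Probability.Percolation.KozmaNitzan.Cells (oth oth_ne eq_oth_of_ne oth_oth)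
open Literature.Barriers.CriticalPhenomena (graphBall graphBall_finite mem_graphBall_self graphBall_mono)
open BoxProdZ2 (ballFin mem_ballFin card_ballFin_le)
open Skel (winGraph winGraph_adj winLevel mem_winLevel_iff winLevel_monotone winLevel_subset_graphBall winLData winLData_X inNbr KitGeom
  cylBallFin mem_cylBallFin pathIn_cylBall' cylBall_subset_cyl)

variable {V : Type} {G : SimpleGraph V} [G.LocallyFinite] (Φ : PlanarSkeletonConc G)

/-! ## §1 Straight step-walks, the tangential target and the deep slab centre -/

/-- **The straight `step`-walk** from `v` in coordinate `i` with sign `s`: `p₀ = v`, `p_{k+1}` a `step`-neighbour of `p_k` with `φ` moved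
by `s e_i`. [cite: KozmaNitzan2024, §4 p. 21] -/
def walk (i : Fin 2) (s : ℤˣ) (v : V) : ℕ → V
  | 0 => v
  | k + 1 => Classical.choose (Φ.step (walk i s v k) i s)

/-- Consecutive walk vertices are adjacent. [folklore] -/
theorem walk_adj (i : Fin 2) (s : ℤˣ) (v : V) (k : ℕ) : G.Adj (walk Φ i s v k) (walk Φ i s v (k + 1)) :=
  (Classical.choose_spec (Φ.step (walk Φ i s v k) i s)).1

/-- Skeleton coordinates along the walk: `φ p_k = φ v + k s e_i`. [folklore] -/
theorem φ_walk (i : Fin 2) (s : ℤˣ) (v : V) (k : ℕ) : Φ.φ (walk Φ i s v k) = Φ.φ v + Pi.single i ((k : ℤ) * (s : ℤ)) := by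
  induction k with
  | zero => simp [walk]
  | succ k ih =>
    show Φ.φ (Classical.choose (Φ.step (walk Φ i s v k) i s)) = _
    rw [(Classical.choose_spec (Φ.step (walk Φ i s v k) i s)).2, ih, add_assoc, ← Pi.single_add]
    congr 2; push_cast; ring

/-- The walk stays in the graph ball: `p_k ∈ B_G(v, k)`. [folklore] -/
theorem walk_mem_graphBall (i : Fin 2) (s : ℤˣ) (v : V) (k : ℕ) : walk Φ i s v k ∈ graphBall G v k := by
  induction k with
  | zero => exact mem_graphBall_self G v 0
  | succ k ih => exact BoxProdZ2.mem_graphBall_succ_of_adj G ih (walk_adj Φ i s v k)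

/-- **The tangential offset** `T₀ = 2ℓs + 2 + M`. [cite: KozmaNitzan2024, §4 p. 21] -/
def tanOff (ℓs M : ℕ) : ℕ := 2 * ℓs + 2 + M

/-- **The tangential target**: `φ y i₁` clamped into `[Lo i₁ + T₀, Hi i₁ − T₀]`. [folklore] -/
def tanTgt (Lo Hi : Site 2) (ℓs M : ℕ) (i₁ : Fin 2) (z : Site 2) : ℤ :=
  max (Lo i₁ + tanOff ℓs M) (min (z i₁) (Hi i₁ - tanOff ℓs M))

/-- The tangential target lies in `[Lo i₁ + T₀, Hi i₁ − T₀]` (side `≥ 2T₀`). [folklore] -/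
theorem tanTgt_mem {Lo Hi : Site 2} {ℓs M : ℕ} (i₁ : Fin 2) (hw : Lo i₁ + 2 * tanOff ℓs M ≤ Hi i₁) (z : Site 2) :
    Lo i₁ + tanOff ℓs M ≤ tanTgt Lo Hi ℓs M i₁ z ∧ tanTgt Lo Hi ℓs M i₁ z ≤ Hi i₁ - tanOff ℓs M := by
  simp only [tanTgt, max_def, min_def]; split_ifs <;> constructor <;> omega

/-- The tangential target is within `T₀` of `z i₁ ∈ [Lo i₁, Hi i₁]`. [folklore] -/
theorem natAbs_tanTgt_sub_le {Lo Hi : Site 2} {ℓs M : ℕ} (i₁ : Fin 2) (hw : Lo i₁ + 2 * tanOff ℓs M ≤ Hi i₁) {z : Site 2}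
    (h1 : Lo i₁ ≤ z i₁) (h2 : z i₁ ≤ Hi i₁) : (tanTgt Lo Hi ℓs M i₁ z - z i₁).natAbs ≤ tanOff ℓs M := by
  have h := tanTgt_mem i₁ hw z
  simp only [tanTgt, max_def, min_def] at h ⊢; split_ifs at * <;> omega

/-- The sign of the tangential displacement. [folklore] -/
def tanSign (d : ℤ) : ℤˣ := if 0 ≤ d then 1 else -1

omit [G.LocallyFinite] Φ in
/-- `|d| · sign d = d`. [folklore] -/
theorem natAbs_mul_tanSign (d : ℤ) : ((d.natAbs : ℕ) : ℤ) * (tanSign d : ℤ) = d := by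
  unfold tanSign; split_ifs with h
  · rw [Units.val_one, mul_one]; omega
  · rw [Units.val_neg, Units.val_one, mul_neg, mul_one]; omega

/-- **The near region's path** of a contact: `p_k = walk i₁ s (inward y) k` with `i₁ = oth i₀`, `s` the sign of `τ − φ y i₁`,
`k ≤ K = |τ − φ y i₁|` (all data read off `y` and the exit coordinate `i₀`). [cite: KozmaNitzan2024, §4 p. 21] -/
def pathPt (Lo Hi : Site 2) (ℓs M : ℕ) (i₀ : Fin 2) (y : V) (k : ℕ) : V :=
  walk Φ (oth i₀) (tanSign (tanTgt Lo Hi ℓs M (oth i₀) (Φ.φ y) - Φ.φ y (oth i₀))) (inward Φ Lo Hi i₀ y) k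

/-- The number of tangential steps `K = |τ − φ y i₁|`. [folklore] -/
def pathLen (Lo Hi : Site 2) (ℓs M : ℕ) (i₀ : Fin 2) (y : V) : ℕ :=
  (tanTgt Lo Hi ℓs M (oth i₀) (Φ.φ y) - Φ.φ y (oth i₀)).natAbs

/-- The path as a finite set `{p₀, …, p_K}`. [folklore] -/
def pathFin [DecidableEq V] (Lo Hi : Site 2) (ℓs M : ℕ) (i₀ : Fin 2) (y : V) : Finset V :=
  (Finset.range (pathLen Φ Lo Hi ℓs M i₀ y + 1)).image (pathPt Φ Lo Hi ℓs M i₀ y)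

/-- **The deep point** over which the slab centre sits: exit coordinate `φ y i₀ − σ(ℓs+1)`, tangential coordinate `τ`. [folklore] -/
def deepPt (Lo Hi : Site 2) (ℓs M : ℕ) (d : Fin 2 × ℤˣ) (z : Site 2) : Site 2 :=
  fun i => if i = d.1 then z i - (d.2 : ℤ) * (ℓs + 1) else tanTgt Lo Hi ℓs M i z

/-- **The deep slab centre** of a contact `x`: a vertex over `deepPt` reached from `y` by outward unit steps.
[cite: KozmaNitzan2024, §4 p. 21 (v(P))] -/
def deepCtr (w₀ : V) (R : ℕ) (Lo Hi : Site 2) (ℓs M : ℕ) (x : V) : V :=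
  Classical.choose (Φ.toPlanarSkeleton.exists_mem_graphBall_φ_eq Φ.step (inNbr Φ w₀ R (Finset.Icc Lo Hi) x)
    (deepPt Lo Hi ℓs M (exitDir Φ w₀ R Lo Hi x) (Φ.φ (inNbr Φ w₀ R (Finset.Icc Lo Hi) x))))

/-- Specification of the deep centre: within graph distance `ℓs + 1 + T₀` of `y` and `φ (deepCtr) = deepPt`. [folklore] -/
theorem deepCtr_spec {w₀ : V} {R : ℕ} {Lo Hi : Site 2} {ℓs M : ℕ} (hw : ∀ i, Lo i + 2 * tanOff ℓs M ≤ Hi i) {x : V}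
    (hy : Φ.φ (inNbr Φ w₀ R (Finset.Icc Lo Hi) x) ∈ Finset.Icc Lo Hi) :
    deepCtr Φ w₀ R Lo Hi ℓs M x ∈ graphBall G (inNbr Φ w₀ R (Finset.Icc Lo Hi) x) (ℓs + 1 + tanOff ℓs M) ∧
      Φ.φ (deepCtr Φ w₀ R Lo Hi ℓs M x) =
        deepPt Lo Hi ℓs M (exitDir Φ w₀ R Lo Hi x) (Φ.φ (inNbr Φ w₀ R (Finset.Icc Lo Hi) x)) := by
  set y := inNbr Φ w₀ R (Finset.Icc Lo Hi) x
  have h := Classical.choose_spec (Φ.toPlanarSkeleton.exists_mem_graphBall_φ_eq Φ.step y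
    (deepPt Lo Hi ℓs M (exitDir Φ w₀ R Lo Hi x) (Φ.φ y)))
  refine ⟨graphBall_mono G y ?_ h.1, h.2⟩
  rw [Finset.mem_Icc] at hy
  -- per-coordinate distances: `ℓs + 1` in the exit coordinate, `≤ T₀` in the other
  have hc : ∀ i, (deepPt Lo Hi ℓs M (exitDir Φ w₀ R Lo Hi x) (Φ.φ y) i - Φ.φ y i).natAbs ≤
      if i = (exitDir Φ w₀ R Lo Hi x).1 then ℓs + 1 else tanOff ℓs M := by
    intro i
    by_cases hi0 : i = (exitDir Φ w₀ R Lo Hi x).1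
    · rw [if_pos hi0]; simp only [deepPt, if_pos hi0]
      rcases Int.units_eq_one_or (exitDir Φ w₀ R Lo Hi x).2 with h1 | h1 <;> rw [h1] <;> push_cast <;> omega
    · rw [if_neg hi0]; simp only [deepPt, if_neg hi0]
      exact natAbs_tanTgt_sub_le i (hw i) (hy.1 i) (hy.2 i)
  have h0 := hc 0; have h1 := hc 1
  have hne : (0 : Fin 2) ≠ 1 := by decide
  by_cases he : (exitDir Φ w₀ R Lo Hi x).1 = 0
  · rw [he] at h0 h1; rw [if_pos rfl] at h0; rw [if_neg hne.symm] at h1; omega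
  · have he1 : (exitDir Φ w₀ R Lo Hi x).1 = 1 := by
      rcases Fin.eq_zero_or_eq_succ ((exitDir Φ w₀ R Lo Hi x).1) with h | ⟨k, hk⟩
      · exact absurd h he
      · rw [hk]; exact congrArg Fin.succ (Fin.eq_zero k)
    rw [he1] at h0 h1; rw [if_neg hne] at h0; rw [if_pos rfl] at h1; omega

/-- The exit coordinate of the deep centre: `φ t i₀ = φ y i₀ − σ (ℓs + 1)`. [folklore] -/
theorem φ_deepCtr_exit {w₀ : V} {R : ℕ} {Lo Hi : Site 2} {ℓs M : ℕ} (hw : ∀ i, Lo i + 2 * tanOff ℓs M ≤ Hi i) {x : V}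
    (hy : Φ.φ (inNbr Φ w₀ R (Finset.Icc Lo Hi) x) ∈ Finset.Icc Lo Hi) :
    Φ.φ (deepCtr Φ w₀ R Lo Hi ℓs M x) (exitDir Φ w₀ R Lo Hi x).1 =
      Φ.φ (inNbr Φ w₀ R (Finset.Icc Lo Hi) x) (exitDir Φ w₀ R Lo Hi x).1 - ((exitDir Φ w₀ R Lo Hi x).2 : ℤ) * (ℓs + 1) := by
  rw [(deepCtr_spec Φ hw hy).2]; simp [deepPt]

/-- The tangential coordinate of the deep centre is the tangential target, at depth `≥ T₀`. [folklore] -/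
theorem φ_deepCtr_tan {w₀ : V} {R : ℕ} {Lo Hi : Site 2} {ℓs M : ℕ} (hw : ∀ i, Lo i + 2 * tanOff ℓs M ≤ Hi i) {x : V}
    (hy : Φ.φ (inNbr Φ w₀ R (Finset.Icc Lo Hi) x) ∈ Finset.Icc Lo Hi) :
    Φ.φ (deepCtr Φ w₀ R Lo Hi ℓs M x) (oth (exitDir Φ w₀ R Lo Hi x).1) =
      tanTgt Lo Hi ℓs M (oth (exitDir Φ w₀ R Lo Hi x).1) (Φ.φ (inNbr Φ w₀ R (Finset.Icc Lo Hi) x)) := by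
  rw [(deepCtr_spec Φ hw hy).2]; simp [deepPt, oth_ne]

/-- Coordinates along the path: exit coordinate `φ y i₀ ∓ 1` (one step off the face), tangential coordinate `φ y i₁ + k s`.
[folklore] -/
theorem φ_pathPt {Lo Hi : Site 2} {ℓs M : ℕ} (i₀ : Fin 2) (hw2 : Lo i₀ + 2 ≤ Hi i₀) {y : V} (hy : Φ.φ y ∈ Finset.Icc Lo Hi) (k : ℕ) :
    Φ.φ (pathPt Φ Lo Hi ℓs M i₀ y k) i₀ = slabPt Lo Hi 1 (Φ.φ y) i₀ ∧
      Φ.φ (pathPt Φ Lo Hi ℓs M i₀ y k) (oth i₀) =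
        Φ.φ y (oth i₀) + (k : ℤ) * (tanSign (tanTgt Lo Hi ℓs M (oth i₀) (Φ.φ y) - Φ.φ y (oth i₀)) : ℤ) := by
  obtain ⟨-, h1, h2⟩ := inward_spec Φ i₀ hw2 hy
  unfold pathPt
  rw [φ_walk]
  refine ⟨?_, ?_⟩
  · rw [Pi.add_apply, Pi.single_eq_of_ne (oth_ne i₀).symm, add_zero, h1]
  · rw [Pi.add_apply, Pi.single_eq_same, h2 _ (oth_ne i₀)]

/-- The last path vertex sits over `(φ y i₀ ∓ 1, τ)`. [folklore] -/
theorem φ_pathPt_last {Lo Hi : Site 2} {ℓs M : ℕ} (i₀ : Fin 2) (hw2 : Lo i₀ + 2 ≤ Hi i₀) {y : V} (hy : Φ.φ y ∈ Finset.Icc Lo Hi) :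
    Φ.φ (pathPt Φ Lo Hi ℓs M i₀ y (pathLen Φ Lo Hi ℓs M i₀ y)) (oth i₀) = tanTgt Lo Hi ℓs M (oth i₀) (Φ.φ y) := by
  rw [(φ_pathPt Φ i₀ hw2 hy _).2, pathLen, natAbs_mul_tanSign]; ring

/-- Consecutive path vertices are adjacent; `p₀ = inward y`. [folklore] -/
theorem pathPt_adj (Lo Hi : Site 2) (ℓs M : ℕ) (i₀ : Fin 2) (y : V) (k : ℕ) :
    G.Adj (pathPt Φ Lo Hi ℓs M i₀ y k) (pathPt Φ Lo Hi ℓs M i₀ y (k + 1)) :=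
  walk_adj Φ _ _ _ k

/-- Path vertices are within graph distance `k + 1` of `y`. [folklore] -/
theorem pathPt_mem_graphBall {Lo Hi : Site 2} {ℓs M : ℕ} (i₀ : Fin 2) (hw2 : Lo i₀ + 2 ≤ Hi i₀) {y : V}
    (hy : Φ.φ y ∈ Finset.Icc Lo Hi) (k : ℕ) : pathPt Φ Lo Hi ℓs M i₀ y k ∈ graphBall G y (k + 1) := by
  have h0 : inward Φ Lo Hi i₀ y ∈ graphBall G y 1 := by
    rcases (inward_spec Φ i₀ hw2 hy).1 with h | h
    · rw [h]; exact mem_graphBall_self G y 1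
    · exact BoxProdZ2.mem_graphBall_succ_of_adj G (mem_graphBall_self G y 0) h
  have h := BoxProdZ2.mem_graphBall_add G h0 (walk_mem_graphBall Φ (oth i₀)
    (tanSign (tanTgt Lo Hi ℓs M (oth i₀) (Φ.φ y) - Φ.φ y (oth i₀))) (inward Φ Lo Hi i₀ y) k)
  unfold pathPt
  exact graphBall_mono G y (by omega) h

end SkelI

end Transplant

end Summit.CriticalPhenomena.PercolationContinuityZ3.Theorems

end
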